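import Literature.NumberTheory.Automorphic.TamagawaHeckeSeries
import Literature.NumberTheory.Automorphic.HeckeSeriesConvergence
import Literature.NumberTheory.Automorphic.GodementJacquetLemma610Bounded
import Literature.NumberTheory.Automorphic.UnramifiedHeckeScalarsFlathProofs
import Literature.NumberTheory.Automorphic.WhittakerCoeffLocalDatum
import Literature.NumberTheory.Automorphic.AdicCompletionResidueCard
import HarnessLib

/-!
# The unramified local factor of the Godement–Jacquet zeta integral in the `L²` model

Topic `NumberTheory/Automorphic`; definitions (`intCosets`, `detExponent`, `intCosetsEquivSigma`,
`rightRegularLocal`, `sphericalVectorsAt`) and theorems. This is the local ingredient of the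
"`K^T`-spherical unfolding" of the global zeta integral `Z(Φ, s, φ, φ')` of
`GodementJacquetZetaIntegrals` by which the named fact
`Literature.NumberTheory.Automorphic.GodementJacquet1972_gjZeta_eulerFactorisation` (decomposition
of `godementJacquet_hasMeromorphicContinuation`, lang.S21) is proved without Flath's tensor-product
theorem: the unramified Euler factor at a finite place `w` is produced *inside* the cuspidal
representation `Π ≤ L²`, by letting the local Hecke algebra act on the spherical vectors of `Π`.

**Abstract part** (a field `F` with a valuative relation, finite residue field, uniformizing
element `ϖ`, `K = GL_n(𝒪)`). `intCosets n F = Δ K / K` is the set of left cosets of integral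
matrices, `detExponent` the exponent `m(y)` with `y ∈ Δ_m` (`|det y| = |ϖ|^m`), and
`intCosetsEquivSigma : Δ K / K ≃ Σ_m Δ_m K / K`. If the operators `T(ϖ^m) = ∑_{y K ⊆ Δ_m} ρ(y)`
(`heckeDetOperator`, `TamagawaHeckeSeries`) act on a vector `x` of a representation `ρ` by scalars
`r_m`, `|r_m| ≤ A D^m`, `#(Δ_m K/K) ≤ D^m`, and `ℓ` is a linear functional with `|ℓ(ρ(g) x)| ≤ B`,
then for `|X| D < 1` (`hasSum_intCosets_pow_detExponent_mul`)
`∑_{y K ⊆ Δ} X^{m(y)} ℓ(ρ(y) x) = (∑_m r_m X^m) ℓ(x)`, absolutely convergent; and the counting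
series `Λ(t) = ∑_{y K ⊆ Δ} t^{m(y)}` satisfies `1 ≤ Λ(t) ≤ 1 + tD/(1 - tD)`
(`exists_hasSum_intCosets_pow_detExponent`).

**Adelic part** (`K` a number field, `Π` a cuspidal automorphic representation of `GL_n(𝔸_K)` in
`L² = L²(GL_n(K) A_G ∖ GL_n(𝔸_K), μ)`, `w` a finite place). With `ρ_w = R ∘ ι_w`
(`rightRegularLocal`, `ι_w = GLn.ofLocal`) and `Π^{GL_n(𝒪_w)} = sphericalVectorsAt μ Π w ⊂ L²`:

* `exists_heckeOperator_rightRegularLocal_eq_smul`: every `[GL_n(𝒪_w) g GL_n(𝒪_w)]` acts on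
  `Π^{GL_n(𝒪_w)}` by a scalar — the theorem `Flath1979_heckeOperatorAt_sphericalLevelAt_eq_smul_holds`
  (`UnramifiedHeckeScalarsFlathProofs`: irreducibility + Gelfand pair) read in `L²`
  (`coe_heckeOperator_toContRep_apply`, `heckeOperator_map_apply_eq`, `glInt_adicCompletion_eq`);
* `heckeOperator_rightRegularLocal_heckeDiag_eq_smul`: a Satake parameter `α` of `Π` at `w`
  (`HasSatakeParameterAt`, any level `K(𝔫)`, `w ∤ 𝔫`) gives `T_i x = q_w^{i(n-i)/2} e_i(α) x` on
  all of `Π^{GL_n(𝒪_w)}`;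
* `exists_heckeDetEigenvalues_rightRegularLocal`: `T(ϖ^m)` acts on `Π^{GL_n(𝒪_w)}` by `r_m` with
  `(∑ r_m X^m) ∏_{a ∈ α} (1 - q_w^{(n-1)/2} a X) = 1` (Tamagawa's identity in Satake form,
  `mk_heckeDetEigenvalue_mul_eulerFactor_eq_one`) and `|r_m|, #(Δ_m K/K) ≤ (2^n q_w^{n²})^m`;
* `hasSum_intCosets_inner_rightRegularLocal`: for spherical `x ∈ Π`, `ψ ∈ L²`, `|X| D < 1`,
  `∑_{y GL_n(𝒪_w) ⊆ Δ^{(w)}} X^{m(y)} ⟪ψ, R(ι_w y) x⟫ = (∏_{a ∈ α} (1 - q_w^{(n-1)/2} a X))⁻¹ ⟪ψ, x⟫`;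
  with `X = q_w^{-s-(n-1)/2}` and `|det y|_w = q_w^{-m(y)}` (`norm_det_out_eq_inv_pow`) this is the
  unramified local factor `L(s, Π_w) ⟪ψ, x⟫` of the unfolded global integral — the `L²`-model form
  of Godement–Jacquet (1972), Lemma 6.10.

## References

* R. Godement, H. Jacquet, *Zeta functions of simple algebras*, LNM 260 (1972), Lemma 6.10
  [GodementJacquet1972] (not held; statement as used in `GodementJacquetZetaIntegrals`).
* G. Shimura, *Introduction to the arithmetic theory of automorphic functions* (1971), Thm. 3.21
  (Tamagawa's rationality theorem; read, pp. 78–83 of the held copy) [ShimuraIATAF1971].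
* D. Flath, *Decomposition of representations into tensor products*, Corvallis (1979), Thm. 3
  [FlathCorvallis1979]; D. Bump, *Automorphic forms and representations* (1997), §3.3.
-/

noncomputable section

open scoped MatrixGroups NNReal
open ValuativeRel Literature.LinearAlgebra.Matrix.Echelon

namespace Literature.NumberTheory.Automorphic

/-! ### Pointwise scalars on a subspace are uniform -/

section UniformScalar

variable {k V : Type*} [Field k] [AddCommGroup V] [Module k V]

/-- If an endomorphism `T` acts on every vector of a subspace `W` by *some* scalar, it acts on
`W` by one scalar (compare `T (v + v₀)` with `T v`, `T v₀`). [folklore] -/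
theorem exists_forall_apply_eq_smul_of_forall_exists (T : Module.End k V) (W : Submodule k V)
    (h : ∀ v ∈ W, ∃ c : k, T v = c • v) : ∃ c : k, ∀ v ∈ W, T v = c • v := by
  by_cases hW : ∀ v ∈ W, v = 0
  · exact ⟨0, fun v hv => by rw [hW v hv, map_zero, smul_zero]⟩
  simp only [not_forall] at hW
  obtain ⟨v₀, hv₀, hv₀0⟩ := hW
  obtain ⟨c₀, hc₀⟩ := h v₀ hv₀
  refine ⟨c₀, fun v hv => ?_⟩
  obtain ⟨cv, hcv⟩ := h v hv
  obtain ⟨c', hc'⟩ := h (v + v₀) (W.add_mem hv hv₀)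
  have key : (cv - c') • v = (c' - c₀) • v₀ := by
    rw [map_add, hcv, hc₀, smul_add] at hc'
    rw [sub_smul, sub_smul, sub_eq_iff_eq_add, sub_add_eq_add_sub, eq_sub_iff_add_eq, hc',
      add_comm]
  by_cases hc : cv = c'
  · rw [hc, sub_self, zero_smul] at key
    have h0 := (smul_eq_zero.1 key.symm).resolve_right hv₀0
    rw [sub_eq_zero] at h0
    rw [hcv, hc, h0]
  · have hne : cv - c' ≠ 0 := sub_ne_zero.2 hc
    have hv' : v = ((cv - c')⁻¹ * (c' - c₀)) • v₀ := by
      rw [mul_smul, ← key, smul_smul, inv_mul_cancel₀ hne, one_smul]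
    rw [hv', map_smul, hc₀, smul_comm]

end UniformScalar

/-! ### Integral cosets of `GL_n` over a local field and their determinant exponent -/

section IntCosets

variable {n : ℕ} {F : Type*} [Field F] [ValuativeRel F]

variable (n F) in
/-- The set `Δ K / K` of left cosets of `K = GL_n(𝒪)` consisting of integral matrices (`Δ = GL_n(F) ∩
M_n(𝒪)`; the integrality of the chosen representative `Quotient.out` does not depend on the
choice). Shimura (1971), §3.2; Godement–Jacquet (1972), §6. [folklore] -/
def intCosets : Set (GL (Fin n) F ⧸ glInt n F) :=
  {c | IsIntegralMatrix ((c.out : GL (Fin n) F) : Matrix (Fin n) (Fin n) F)}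

/-- Membership in `intCosets` (definitional). [folklore] -/
theorem mem_intCosets_iff {c : GL (Fin n) F ⧸ glInt n F} :
    c ∈ intCosets n F ↔ IsIntegralMatrix ((c.out : GL (Fin n) F) : Matrix (Fin n) (Fin n) F) :=
  Iff.rfl

/-- `y K ∈ Δ K / K ↔ y` integral. [folklore] -/
theorem mk_mem_intCosets_iff (y : GL (Fin n) F) :
    (y : GL (Fin n) F ⧸ glInt n F) ∈ intCosets n F ↔
      IsIntegralMatrix (y : Matrix (Fin n) (Fin n) F) := by
  rw [mem_intCosets_iff]
  obtain ⟨κ, hκ, hy⟩ : ∃ κ ∈ glInt n F, ((y : GL (Fin n) F ⧸ glInt n F).out : GL (Fin n) F) = y * κ := by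
    have h := QuotientGroup.mk_out_eq_mul (glInt n F) y
    exact ⟨_, h.choose.2, h.choose_spec⟩
  rw [hy]
  exact isIntegralMatrix_mul_glInt_iff hκ y

variable {ϖ : F}

/-- The **determinant exponent** `m(c)` of an integral coset `c = y K`: the unique `m` with
`y ∈ Δ_m`, i.e. `|det y| = |ϖ|^m` (`exists_mem_glIntDet`, `eq_of_mem_glIntDet`). [folklore] -/
def detExponent [IsDiscreteValuationRing 𝒪[F]] (hϖ : IsUniformizingElement ϖ)
    (c : intCosets n F) : ℕ :=
  Classical.choose (exists_mem_glIntDet hϖ c.2)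

/-- The defining property of `detExponent`: `y ∈ Δ_{m(y)}`. [folklore] -/
theorem out_mem_glIntDet_detExponent [IsDiscreteValuationRing 𝒪[F]] (hϖ : IsUniformizingElement ϖ)
    (c : intCosets n F) : (c.1.out : GL (Fin n) F) ∈ glIntDet n ϖ (detExponent hϖ c) :=
  Classical.choose_spec (exists_mem_glIntDet hϖ c.2)

/-- `m(y) = m ↔ y ∈ Δ_m` (uniqueness, `eq_of_mem_glIntDet`). [folklore] -/
theorem detExponent_eq_iff [IsDiscreteValuationRing 𝒪[F]] (hϖ : IsUniformizingElement ϖ)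
    (c : intCosets n F) {m : ℕ} :
    detExponent hϖ c = m ↔ (c.1.out : GL (Fin n) F) ∈ glIntDet n ϖ m :=
  ⟨fun h => h ▸ out_mem_glIntDet_detExponent hϖ c,
    fun h => eq_of_mem_glIntDet hϖ (out_mem_glIntDet_detExponent hϖ c) h⟩

/-- `Δ K / K ≃ Σ_m (Δ_m K / K)`, sorting integral cosets by their determinant exponent. [folklore] -/
def intCosetsEquivSigma [IsDiscreteValuationRing 𝒪[F]] (hϖ : IsUniformizingElement ϖ) :
    intCosets n F ≃ Σ m : ℕ, {c : GL (Fin n) F ⧸ glInt n F | c.out ∈ glIntDet n ϖ m} where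
  toFun c := ⟨detExponent hϖ c, ⟨c.1, out_mem_glIntDet_detExponent hϖ c⟩⟩
  invFun p := ⟨p.2.1, p.2.2.1⟩
  left_inv c := rfl
  right_inv p := by
    obtain ⟨m, c, hc⟩ := p
    have hm : detExponent hϖ ⟨c, hc.1⟩ = m := (detExponent_eq_iff hϖ ⟨c, hc.1⟩).2 hc
    have key : ∀ (m' : ℕ) (h' : c.out ∈ glIntDet n ϖ m'), m' = m →
        (⟨m', ⟨c, h'⟩⟩ : Σ m, {c : GL (Fin n) F ⧸ glInt n F | c.out ∈ glIntDet n ϖ m}) =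
          ⟨m, ⟨c, hc⟩⟩ := by
      rintro m' h' rfl
      rfl
    exact key _ _ hm

/-- The first component of `intCosetsEquivSigma` is the determinant exponent. [folklore] -/
@[simp]
theorem intCosetsEquivSigma_apply_fst [IsDiscreteValuationRing 𝒪[F]] (hϖ : IsUniformizingElement ϖ)
    (c : intCosets n F) : (intCosetsEquivSigma hϖ c).1 = detExponent hϖ c := rfl

/-- The second component of `intCosetsEquivSigma` is the coset itself. [folklore] -/
@[simp]
theorem intCosetsEquivSigma_apply_snd [IsDiscreteValuationRing 𝒪[F]] (hϖ : IsUniformizingElement ϖ)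
    (c : intCosets n F) : ((intCosetsEquivSigma hϖ c).2 : GL (Fin n) F ⧸ glInt n F) = c.1 := rfl

end IntCosets

/-! ### The local unramified Hecke series over integral cosets -/

section Series

variable {n : ℕ} {F : Type*} [Field F] [ValuativeRel F] [Finite 𝓀[F]] {ϖ : F}

/-- `∑' c ∈ S, f c = ∑ c ∈ hS.toFinset, f c` for a finite set of cosets. [folklore] -/
theorem tsum_coe_eq_sum_toFinset {β α : Type*} [AddCommMonoid α] [TopologicalSpace α] [T2Space α]
    {S : Set β} (hS : S.Finite) (f : β → α) : ∑' c : S, f c = ∑ c ∈ hS.toFinset, f c := by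
  rw [tsum_congr_set_coe f hS.coe_toFinset.symm]
  exact Finset.tsum_subtype _ f

/-- Summability of the majorant `B t^{m(c)}` over `Δ K / K ≃ Σ_m Δ_m K / K` when
`#(Δ_m K / K) ≤ D^m` and `t D < 1`. [folklore] -/
theorem summable_sigma_const_mul_pow (hϖ : IsUniformizingElement ϖ) {D t B : ℝ} (hD : 0 ≤ D)
    (ht : 0 ≤ t) (hB : 0 ≤ B)
    (hcard : ∀ m, ((finite_cosets_glIntDet (n := n) hϖ m).toFinset.card : ℝ) ≤ D ^ m)
    (htD : t * D < 1) :
    Summable (fun p : (Σ m : ℕ, {c : GL (Fin n) F ⧸ glInt n F | c.out ∈ glIntDet n ϖ m}) =>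
      B * t ^ p.1) := by
  refine (summable_sigma_of_nonneg fun p => by positivity).2 ⟨fun m => ?_, ?_⟩
  · haveI : Finite {c : GL (Fin n) F ⧸ glInt n F | c.out ∈ glIntDet n ϖ m} :=
      (finite_cosets_glIntDet hϖ m).to_subtype
    exact Summable.of_finite
  · have hval : ∀ m, (∑' c : {c : GL (Fin n) F ⧸ glInt n F | c.out ∈ glIntDet n ϖ m}, B * t ^ m) =
        (finite_cosets_glIntDet (n := n) hϖ m).toFinset.card * (B * t ^ m) := fun m => by
      rw [tsum_coe_eq_sum_toFinset (finite_cosets_glIntDet hϖ m) (fun _ => B * t ^ m),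
        Finset.sum_const, nsmul_eq_mul]
    simp_rw [hval]
    refine Summable.of_nonneg_of_le (fun m => by positivity)
      (fun m => ?_) ((summable_geometric_of_lt_one (by positivity) htD).mul_left B)
    calc ((finite_cosets_glIntDet (n := n) hϖ m).toFinset.card : ℝ) * (B * t ^ m)
        ≤ D ^ m * (B * t ^ m) := mul_le_mul_of_nonneg_right (hcard m) (by positivity)
      _ = B * (t * D) ^ m := by rw [mul_pow]; ring

/-- **The local unramified Hecke series over integral cosets.** Let `ρ` be a representation of
`GL_n(F)` on `V`, `ℓ` a linear functional, and `x ∈ V` a vector on which the operators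
`T(ϖ^m) = ∑_{y K ⊆ Δ_m} ρ(y)` act by scalars `r_m` (`heckeDetOperator`), with
`‖ℓ(ρ(g) x)‖ ≤ B` (bounded coefficient), `|r_m| ≤ A D^m` and `#(Δ_m K / K) ≤ D^m`. Then for
`|X| D < 1` the series over all integral cosets `∑_{y K ⊆ Δ} X^{m(y)} ℓ(ρ(y) x)` converges
absolutely and equals `(∑_m r_m X^m) ℓ(x)` (sort the cosets by `m(y) = v(det y)`; on `Δ_m K / K`
the sum is `ℓ(T(ϖ^m) x) = r_m ℓ(x)`). With `X = q^{-s}` this is the coefficient form of the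
unramified computation of Godement–Jacquet (1972), Lemma 6.10 / Tamagawa (1963).
[cite: GodementJacquet1972, Lemma 6.10] -/
theorem hasSum_intCosets_pow_detExponent_mul [IsDiscreteValuationRing 𝒪[F]]
    (hϖ : IsUniformizingElement ϖ) {V : Type*} [AddCommGroup V] [Module ℂ V]
    (ρ : Representation ℂ (GL (Fin n) F) V) (ℓ : V →ₗ[ℂ] ℂ) {x : V} {r : ℕ → ℂ}
    (hr : ∀ m, heckeDetOperator ρ ϖ m x = r m • x) {B : ℝ} (hB : ∀ g, ‖ℓ (ρ g x)‖ ≤ B)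
    {A D : ℝ} (hD : 0 ≤ D) (hrA : ∀ m, ‖r m‖ ≤ A * D ^ m)
    (hcard : ∀ m, ((finite_cosets_glIntDet (n := n) hϖ m).toFinset.card : ℝ) ≤ D ^ m)
    {X : ℂ} (hX : ‖X‖ * D < 1) :
    Summable (fun m => r m * X ^ m) ∧
      HasSum (fun c : intCosets n F => X ^ detExponent hϖ c * ℓ (ρ (c.1.out : GL (Fin n) F) x))
        ((∑' m, r m * X ^ m) * ℓ x) := by
  have hB0 : 0 ≤ B := (norm_nonneg _).trans (hB 1)
  have hA0 : 0 ≤ A := by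
    have h := hrA 0
    rw [pow_zero, mul_one] at h
    exact (norm_nonneg _).trans h
  have hgeom : Summable fun m : ℕ => (‖X‖ * D) ^ m :=
    summable_geometric_of_lt_one (by positivity) hX
  have hsum_r : Summable fun m => r m * X ^ m := by
    refine Summable.of_norm_bounded (hgeom.mul_left A) fun m => ?_
    rw [norm_mul, norm_pow, mul_pow]
    calc ‖r m‖ * ‖X‖ ^ m ≤ A * D ^ m * ‖X‖ ^ m :=
          mul_le_mul_of_nonneg_right (hrA m) (pow_nonneg (norm_nonneg X) m)
      _ = A * (‖X‖ ^ m * D ^ m) := by ring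
  refine ⟨hsum_r, ?_⟩
  set e := intCosetsEquivSigma (n := n) hϖ
  set f : (Σ m : ℕ, {c : GL (Fin n) F ⧸ glInt n F | c.out ∈ glIntDet n ϖ m}) → ℂ :=
    fun p => X ^ p.1 * ℓ (ρ (p.2.1.out : GL (Fin n) F) x) with hf
  have hfs : Summable f := by
    refine Summable.of_norm_bounded
      (summable_sigma_const_mul_pow hϖ hD (norm_nonneg X) hB0 hcard hX) fun p => ?_
    rw [hf, norm_mul, norm_pow, mul_comm]
    exact mul_le_mul_of_nonneg_right (hB _) (pow_nonneg (norm_nonneg X) _)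
  have hinner : ∀ m, HasSum (fun c : {c : GL (Fin n) F ⧸ glInt n F | c.out ∈ glIntDet n ϖ m} =>
      f ⟨m, c⟩) (X ^ m * (r m * ℓ x)) := by
    intro m
    haveI : Finite {c : GL (Fin n) F ⧸ glInt n F | c.out ∈ glIntDet n ϖ m} :=
      (finite_cosets_glIntDet hϖ m).to_subtype
    have hval : (∑' c : {c : GL (Fin n) F ⧸ glInt n F | c.out ∈ glIntDet n ϖ m}, f ⟨m, c⟩) =
        X ^ m * (r m * ℓ x) := by
      simp only [hf]
      rw [tsum_mul_left, tsum_coe_eq_sum_toFinset (finite_cosets_glIntDet hϖ m)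
        (fun c => ℓ (ρ (c.out : GL (Fin n) F) x)), ← map_sum,
        ← heckeDetOperator_apply_eq_sum ρ m (finite_cosets_glIntDet hϖ m) x, hr m, map_smul,
        smul_eq_mul]
    rw [← hval]
    exact (Summable.of_finite).hasSum
  have houter : HasSum (fun m => X ^ m * (r m * ℓ x)) ((∑' m, r m * X ^ m) * ℓ x) := by
    have h := hsum_r.hasSum.mul_right (ℓ x)
    refine h.congr_fun fun m => ?_
    ring
  have htot : HasSum f ((∑' m, r m * X ^ m) * ℓ x) := houter.sigma_of_hasSum hinner hfs
  exact (e.hasSum_iff (f := f)).2 htot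

/-- `Δ_0 K / K = {K}` has one element. [folklore] -/
theorem card_cosets_glIntDet_zero (hϖ : IsUniformizingElement ϖ) :
    (finite_cosets_glIntDet (n := n) hϖ 0).toFinset.card = 1 := by
  rw [Finset.card_eq_one]
  refine ⟨((1 : GL (Fin n) F) : GL (Fin n) F ⧸ glInt n F), Finset.ext fun γ => ?_⟩
  rw [Set.Finite.mem_toFinset, Set.mem_setOf_eq, out_mem_glIntDet_zero_iff, Finset.mem_singleton]

/-- **The counting series over integral cosets.** For `0 ≤ t` with `t D < 1`,
`#(Δ_m K / K) ≤ D^m`: `Λ(t) = ∑_{y K ⊆ Δ} t^{m(y)} = ∑_m #(Δ_m K/K) t^m` converges,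
`1 ≤ Λ(t)` (the coset `K`) and `Λ(t) - 1 ≤ t D / (1 - t D)` (the cosets with `m ≥ 1`). This
is the majorant which makes the Euler product over the finite places outside `T` converge.
[folklore] -/
theorem exists_hasSum_intCosets_pow_detExponent [IsDiscreteValuationRing 𝒪[F]]
    (hϖ : IsUniformizingElement ϖ) {D t : ℝ} (hD : 0 ≤ D) (ht : 0 ≤ t)
    (hcard : ∀ m, ((finite_cosets_glIntDet (n := n) hϖ m).toFinset.card : ℝ) ≤ D ^ m)
    (htD : t * D < 1) :
    ∃ Λ : ℝ, HasSum (fun c : intCosets n F => t ^ detExponent hϖ c) Λ ∧ 1 ≤ Λ ∧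
      Λ - 1 ≤ t * D / (1 - t * D) := by
  set e := intCosetsEquivSigma (n := n) hϖ
  set f : (Σ m : ℕ, {c : GL (Fin n) F ⧸ glInt n F | c.out ∈ glIntDet n ϖ m}) → ℝ :=
    fun p => t ^ p.1 with hf
  have hfs : Summable f := by
    have h := summable_sigma_const_mul_pow hϖ hD ht zero_le_one hcard htD
    simp_rw [one_mul] at h
    exact h
  set a : ℕ → ℝ := fun m => ((finite_cosets_glIntDet (n := n) hϖ m).toFinset.card : ℝ) * t ^ m
    with ha
  have hinner : ∀ m, HasSum (fun c : {c : GL (Fin n) F ⧸ glInt n F | c.out ∈ glIntDet n ϖ m} =>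
      f ⟨m, c⟩) (a m) := by
    intro m
    haveI : Finite {c : GL (Fin n) F ⧸ glInt n F | c.out ∈ glIntDet n ϖ m} :=
      (finite_cosets_glIntDet hϖ m).to_subtype
    have hval : (∑' c : {c : GL (Fin n) F ⧸ glInt n F | c.out ∈ glIntDet n ϖ m}, f ⟨m, c⟩) =
        a m := by
      simp only [hf, ha]
      rw [tsum_coe_eq_sum_toFinset (finite_cosets_glIntDet hϖ m) (fun _ => t ^ m),
        Finset.sum_const, nsmul_eq_mul]
    rw [← hval]
    exact (Summable.of_finite).hasSum
  have hgeom : Summable fun m : ℕ => (t * D) ^ m := summable_geometric_of_lt_one (by positivity) htD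
  have ha_le : ∀ m, a m ≤ (t * D) ^ m := fun m => by
    calc a m ≤ D ^ m * t ^ m := mul_le_mul_of_nonneg_right (hcard m) (by positivity)
      _ = (t * D) ^ m := by rw [mul_pow]; ring
  have ha0 : ∀ m, 0 ≤ a m := fun m => by positivity
  have has : Summable a := Summable.of_nonneg_of_le ha0 ha_le hgeom
  have houter : HasSum a (∑' m, a m) := has.hasSum
  have htot : HasSum f (∑' m, a m) := houter.sigma_of_hasSum hinner hfs
  refine ⟨∑' m, a m, (e.hasSum_iff (f := f)).2 htot, ?_, ?_⟩
  · rw [has.tsum_eq_zero_add]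
    have h0 : a 0 = 1 := by rw [ha]; simp [card_cosets_glIntDet_zero hϖ]
    rw [h0, le_add_iff_nonneg_right]
    exact tsum_nonneg fun m => ha0 _
  · rw [has.tsum_eq_zero_add]
    have h0 : a 0 = 1 := by rw [ha]; simp [card_cosets_glIntDet_zero hϖ]
    rw [h0, add_sub_cancel_left]
    have hgeom' : Summable fun m : ℕ => (t * D) ^ (m + 1) :=
      (summable_nat_add_iff 1).2 hgeom
    calc ∑' m, a (m + 1) ≤ ∑' m : ℕ, (t * D) ^ (m + 1) :=
          ((summable_nat_add_iff 1).2 has).tsum_le_tsum (fun m => ha_le (m + 1)) hgeom'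
      _ = t * D * ∑' m : ℕ, (t * D) ^ m := by
          rw [← tsum_mul_left]; exact tsum_congr fun m => by ring
      _ = t * D / (1 - t * D) := by
          rw [tsum_geometric_of_lt_one (by positivity) htD, div_eq_mul_inv]

end Series

/-! ### Hecke operators of a closed subrepresentation, read in the ambient space -/

section Coe

variable {k G V : Type*} [CommRing k] [Group G] [AddCommGroup V] [Module k V] [TopologicalSpace V]
  [IsTopologicalAddGroup V] {π : ContRepresentation k G V}

/-- The Hecke operator `[Kf g Kf]` of a closed subrepresentation `W ≤ V` is the restriction of the
Hecke operator of `V`: on a `Kf`-fixed `f ∈ W` (finite double coset) both are `∑_{x ∈ s} π(x) f`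
for a transversal `s` (`heckeOperator_apply_eq_sum`). [folklore] -/
theorem coe_heckeOperator_toContRep_apply (W : ContRepresentation.ClosedSubrep π)
    (Kf : Subgroup G) (g : G) (hfin : (MulAction.orbit Kf (g : G ⧸ Kf)).Finite)
    {f : W.toSubmodule} (hf : f ∈ W.toContRep.toRepresentation.fixedPoints Kf) :
    ((heckeOperator W.toContRep.toRepresentation Kf g f : W.toSubmodule) : V) =
      heckeOperator π.toRepresentation Kf g (f : V) := by
  classical
  have hs := bijOn_mk_image_out Kf g hfin
  have hf' : (f : V) ∈ π.toRepresentation.fixedPoints Kf := by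
    rw [Representation.mem_fixedPoints] at hf ⊢
    intro x hx
    exact congrArg Subtype.val (hf x hx)
  rw [heckeOperator_apply_eq_sum _ Kf g _ hs hf, heckeOperator_apply_eq_sum _ Kf g _ hs hf',
    Submodule.coe_sum]
  rfl

end Coe

/-! ### The local representation of `GL_n(K_w)` on `L²` and the spherical vectors of `Π` at `w` -/

section Adelic

open NumberField IsDedekindDomain MeasureTheory

variable {n : ℕ} {K : Type} [Field K] [NumberField K]
  (μ : Measure (AdelicGroupData.gl n K).automorphicQuotient)
  [(AdelicGroupData.gl n K).IsAutomorphicMeasure μ]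

/-- The representation of the local group `GL_n(K_w)` on `L² = L²(GL_n(K) A_G ∖ GL_n(𝔸_K), μ)`
obtained from the regular representation `R` through the local embedding `ι_w = GLn.ofLocal`
(`ρ_w = R ∘ ι_w`; Godement–Jacquet (1972), §10; Borel–Jacquet (1979), §4.6). [folklore] -/
def rightRegularLocal (w : HeightOneSpectrum (𝓞 K)) :
    Representation ℂ (GL (Fin n) (w.adicCompletion K)) ((AdelicGroupData.gl n K).L2 μ) :=
  ((AdelicGroupData.gl n K).rightRegular μ).toRepresentation.comp (GLn.ofLocal n K w)

variable {μ}

/-- `rightRegularLocal μ w g = R(ι_w g)` (definitional). [folklore] -/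
@[simp]
theorem rightRegularLocal_apply (w : HeightOneSpectrum (𝓞 K)) (g : GL (Fin n) (w.adicCompletion K))
    (x : (AdelicGroupData.gl n K).L2 μ) :
    rightRegularLocal μ w g x = (AdelicGroupData.gl n K).rightRegular μ (GLn.ofLocal n K w g) x := rfl

variable (μ) in
/-- The **spherical vectors of `Π` at `w`**: the vectors of the closed subrepresentation `Π ≤ L²`
fixed by `GL_n(𝒪_w)` (placed at `w`), `Π^{GL_n(𝒪_w)} = Π ∩ (L²)^{ι_w(GL_n(𝒪_w))}`, as a subspace of
`L²` (Borel–Jacquet (1979), §4.6). [folklore] -/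
def sphericalVectorsAt (P : CuspidalAutomorphicRepGL n K μ) (w : HeightOneSpectrum (𝓞 K)) :
    Submodule ℂ ((AdelicGroupData.gl n K).L2 μ) :=
  P.1.toSubmodule ⊓ (rightRegularLocal μ w).fixedPoints (glInt n (w.adicCompletion K))

/-- Membership in `sphericalVectorsAt`: `x ∈ Π` and `R(ι_w k) x = x` for `k ∈ GL_n(𝒪_w)`. [folklore] -/
theorem mem_sphericalVectorsAt_iff {P : CuspidalAutomorphicRepGL n K μ} {w : HeightOneSpectrum (𝓞 K)}
    {x : (AdelicGroupData.gl n K).L2 μ} :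
    x ∈ sphericalVectorsAt μ P w ↔ x ∈ P.1 ∧ ∀ k ∈ glInt n (w.adicCompletion K),
      (AdelicGroupData.gl n K).rightRegular μ (GLn.ofLocal n K w k) x = x := by
  rw [sphericalVectorsAt, Submodule.mem_inf, Representation.mem_fixedPoints]
  rfl

/-- A spherical vector at `w`, as an element of `Π`, is fixed by the local spherical level
`sphericalLevelAt K n w = ι_w(GL_n(𝒪_w))` (dictionary `glInt_adicCompletion_eq`). [folklore] -/
theorem mem_fixedVectors_sphericalLevelAt_of_mem {P : CuspidalAutomorphicRepGL n K μ}
    {w : HeightOneSpectrum (𝓞 K)} {x : (AdelicGroupData.gl n K).L2 μ}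
    (hx : x ∈ sphericalVectorsAt μ P w) :
    (⟨x, hx.1⟩ : P.1.toSubmodule) ∈
      P.1.fixedVectors (Literature.NumberTheory.Automorphic.sphericalLevelAt K n w) := by
  rw [ContRepresentation.ClosedSubrep.mem_fixedVectors]
  rintro _ ⟨k, hk, rfl⟩
  apply Subtype.ext
  rw [ContRepresentation.ClosedSubrep.coe_toContRep_apply]
  rw [← glInt_adicCompletion_eq] at hk
  exact (mem_sphericalVectorsAt_iff.1 hx).2 k hk

/-- **Dictionary `L²`-local / `Π`-adelic for Hecke operators.** On a spherical vector `x ∈ Π` at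
`w`, the Hecke operator `[GL_n(𝒪_w) g GL_n(𝒪_w)]` of the local representation `ρ_w = R ∘ ι_w` on
`L²` is the adelic Hecke operator `[K_w ι_w(g) K_w]` of `Π` at the local spherical level
`K_w = sphericalLevelAt K n w` (`coe_heckeOperator_toContRep_apply`, `heckeOperator_map_apply_eq`,
`glInt_adicCompletion_eq`; Bump (1997), §3.3). [folklore] -/
theorem heckeOperator_rightRegularLocal_eq_coe {P : CuspidalAutomorphicRepGL n K μ}
    {w : HeightOneSpectrum (𝓞 K)} {x : (AdelicGroupData.gl n K).L2 μ}
    (hx : x ∈ sphericalVectorsAt μ P w) (g : GL (Fin n) (w.adicCompletion K)) :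
    heckeOperator (rightRegularLocal μ w) (glInt n (w.adicCompletion K)) g x =
      ((heckeOperatorAt P.1 (Literature.NumberTheory.Automorphic.sphericalLevelAt K n w)
        (GLn.ofLocal n K w g) ⟨x, hx.1⟩ : P.1.toSubmodule) : (AdelicGroupData.gl n K).L2 μ) := by
  have hfix := mem_fixedVectors_sphericalLevelAt_of_mem hx
  have hfin₀ := finite_orbit_valuedCongruenceSubgroup_one n K w g
  have hfin : (MulAction.orbit (Literature.NumberTheory.Automorphic.sphericalLevelAt K n w)
      (GLn.ofLocal n K w g : GL (Fin n) (AdeleRing (𝓞 K) K) ⧸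
        Literature.NumberTheory.Automorphic.sphericalLevelAt K n w)).Finite :=
    finite_orbit_map (GLn.ofLocal n K w) GLn.ofLocal_injective
      (valuedCongruenceSubgroup (Fin n) (1 : WithZero (Multiplicative ℤ))) g hfin₀
  have hfix' : (⟨x, hx.1⟩ : P.1.toSubmodule) ∈ P.1.toContRep.toRepresentation.fixedPoints
      (Literature.NumberTheory.Automorphic.sphericalLevelAt K n w) := hfix
  rw [heckeOperatorAt, coe_heckeOperator_toContRep_apply P.1
    (Literature.NumberTheory.Automorphic.sphericalLevelAt K n w) _ hfin hfix']
  have hxfix : x ∈ ((AdelicGroupData.gl n K).rightRegular μ).toRepresentation.fixedPoints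
      ((valuedCongruenceSubgroup (Fin n) (1 : WithZero (Multiplicative ℤ))).map
        (GLn.ofLocal n K w)) := by
    rw [Representation.mem_fixedPoints]
    rintro _ ⟨k, hk, rfl⟩
    rw [← glInt_adicCompletion_eq] at hk
    exact (mem_sphericalVectorsAt_iff.1 hx).2 k hk
  have h2 := heckeOperator_map_apply_eq (GLn.ofLocal n K w) GLn.ofLocal_injective
    (valuedCongruenceSubgroup (Fin n) (1 : WithZero (Multiplicative ℤ)))
    ((AdelicGroupData.gl n K).rightRegular μ).toRepresentation g hfin₀ hxfix
  conv at h2 => rhs; rw [← glInt_adicCompletion_eq]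
  exact h2.symm

/-- **The unramified local Hecke operators act on `Π^{GL_n(𝒪_w)}` by scalars**: for every
`g ∈ GL_n(K_w)` there is `c` with `[GL_n(𝒪_w) g GL_n(𝒪_w)] x = c x` (the operator of the local
representation `ρ_w = R ∘ ι_w` on `L²`) for all `x ∈ Π^{GL_n(𝒪_w)}` — the theorem
`Flath1979_heckeOperatorAt_sphericalLevelAt_eq_smul_holds` (irreducibility of `Π`, Gelfand pair
`(GL_n(K_w), GL_n(𝒪_w))`) read through `heckeOperator_rightRegularLocal_eq_coe`
(Flath, Corvallis (1979), Thm. 3; Getz–Hahn (2024), Cor. 5.5.2, §7.1). [folklore] -/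
theorem exists_heckeOperator_rightRegularLocal_eq_smul (P : CuspidalAutomorphicRepGL n K μ)
    (w : HeightOneSpectrum (𝓞 K)) (g : GL (Fin n) (w.adicCompletion K)) :
    ∃ c : ℂ, ∀ x ∈ sphericalVectorsAt μ P w,
      heckeOperator (rightRegularLocal μ w) (glInt n (w.adicCompletion K)) g x = c • x := by
  obtain ⟨c, hc⟩ := Flath1979_heckeOperatorAt_sphericalLevelAt_eq_smul_holds (μ := μ) P w g
  refine ⟨c, fun x hx => ?_⟩
  rw [heckeOperator_rightRegularLocal_eq_coe hx, hc _ (mem_fixedVectors_sphericalLevelAt_of_mem hx)]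
  rfl

/-- **Satake parameters give the eigenvalues of the local `T_i` on all of `Π^{GL_n(𝒪_w)}`.** If
`Π` has Satake parameter `α` at `w` (with respect to some `K(𝔫)`, `w ∤ 𝔫 ≠ 0`, and the
uniformizer `ϖ`), then `[GL_n(𝒪_w) t_i GL_n(𝒪_w)] x = q_w^{i(n-i)/2} e_i(α) x` for every spherical
`x ∈ Π` at `w` and `i ≤ n`, `t_i = diag(ϖ,…,ϖ,1,…,1)`: the eigenvalue equation of
`HasSatakeParameterAt` on its eigenvector `f ≠ 0`, moved to the local spherical level
(`heckeOperator_sphericalLevelAt_eq_principalCongruenceLevel`, `heckeDiagAt_eq_ofLocal`), and the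
scalar action (`exists_heckeOperator_rightRegularLocal_eq_smul`) which makes the eigenvalue the
same on every spherical vector (Borel–Jacquet (1979), §4.6; Bump (1997), §3.3). [folklore] -/
theorem heckeOperator_rightRegularLocal_heckeDiag_eq_smul {P : CuspidalAutomorphicRepGL n K μ}
    {w : HeightOneSpectrum (𝓞 K)} {𝔫 : Ideal (𝓞 K)} (h𝔫 : 𝔫 ≠ 0) (hw : ¬ w.asIdeal ∣ 𝔫)
    {ϖ : (w.adicCompletion K)ˣ} {α : Multiset ℂ}
    (hα : HasSatakeParameterAt P.1 (principalCongruenceLevel n K 𝔫) w ϖ α)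
    {x : (AdelicGroupData.gl n K).L2 μ} (hx : x ∈ sphericalVectorsAt μ P w) {i : ℕ} (hi : i ≤ n) :
    heckeOperator (rightRegularLocal μ w) (glInt n (w.adicCompletion K)) (heckeDiag n ϖ i) x =
      ((((Real.sqrt (w.residueCard : ℝ) : ℝ) : ℂ) ^ (i * (n - i))) * α.esymm i) • x := by
  obtain ⟨-, -, f, hf, hf0, hT⟩ := hα
  obtain ⟨c, hc⟩ := exists_heckeOperator_rightRegularLocal_eq_smul P w (heckeDiag n ϖ i)
  -- `f`, read in `L²`, is a spherical vector at `w`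
  have hfK : ∀ k ∈ principalCongruenceLevel n K 𝔫,
      (AdelicGroupData.gl n K).rightRegular μ k (f : (AdelicGroupData.gl n K).L2 μ) = f := by
    intro k hk
    exact congrArg Subtype.val ((ContRepresentation.ClosedSubrep.mem_fixedVectors _ _ _).1 hf k hk)
  have hfsph : (f : (AdelicGroupData.gl n K).L2 μ) ∈ sphericalVectorsAt μ P w := by
    refine mem_sphericalVectorsAt_iff.2 ⟨f.2, fun k hk => hfK _ ?_⟩
    refine isMaximalAt_principalCongruenceLevel n K w h𝔫 hw ⟨k, ?_, rfl⟩
    rwa [← glInt_adicCompletion_eq]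
  -- the eigenvalue equation for `f` at the local spherical level, in `L²`
  have h1 := hT i hi
  rw [heckeOperatorAt, heckeDiagAt_eq_ofLocal] at h1
  replace h1 := (heckeOperator_sphericalLevelAt_eq_principalCongruenceLevel
    P.1.toContRep.toRepresentation h𝔫 hw (heckeDiag n ϖ i) hf).trans h1
  have h2 := heckeOperator_rightRegularLocal_eq_coe hfsph (heckeDiag n ϖ i)
  have h3 : ((heckeOperatorAt P.1 (Literature.NumberTheory.Automorphic.sphericalLevelAt K n w)
      (GLn.ofLocal n K w (heckeDiag n ϖ i)) ⟨(f : (AdelicGroupData.gl n K).L2 μ), f.2⟩ :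
        P.1.toSubmodule) : (AdelicGroupData.gl n K).L2 μ) =
      ((((Real.sqrt (w.residueCard : ℝ) : ℝ) : ℂ) ^ (i * (n - i))) * α.esymm i) •
        (f : (AdelicGroupData.gl n K).L2 μ) := by
    have hf' : (⟨(f : (AdelicGroupData.gl n K).L2 μ), f.2⟩ : P.1.toSubmodule) = f := rfl
    rw [hf']
    exact congrArg Subtype.val h1
  -- compare the two scalars on `f ≠ 0`
  have hcf := hc _ hfsph
  rw [h2, h3] at hcf
  have hf0' : (f : (AdelicGroupData.gl n K).L2 μ) ≠ 0 := fun h => hf0 (Subtype.ext h)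
  have hceq : c = (((Real.sqrt (w.residueCard : ℝ) : ℝ) : ℂ) ^ (i * (n - i))) * α.esymm i :=
    (smul_left_injective ℂ hf0' hcf).symm
  rw [hc x hx, hceq]

/-- **The operators `T(ϖ^m)` act on `Π^{GL_n(𝒪_w)}` by scalars `r_{w,m}`** (sums of the scalars
of the double cosets in `Δ_m`, `exists_heckeDetOperator_apply_eq_smul`, made uniform on the
subspace by `exists_forall_apply_eq_smul_of_forall_exists`). [folklore] -/
theorem exists_heckeDetOperator_rightRegularLocal_eq_smul (P : CuspidalAutomorphicRepGL n K μ)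
    (w : HeightOneSpectrum (𝓞 K)) {ϖ : w.adicCompletion K} (hϖ : IsUniformizingElement ϖ) (m : ℕ) :
    ∃ r : ℂ, ∀ x ∈ sphericalVectorsAt μ P w,
      heckeDetOperator (rightRegularLocal μ w) ϖ m x = r • x := by
  refine exists_forall_apply_eq_smul_of_forall_exists _ _ fun x hx => ?_
  refine exists_heckeDetOperator_apply_eq_smul (rightRegularLocal μ w) m
    (finite_cosets_glIntDet hϖ m) hx.2 fun g _ => ?_
  obtain ⟨c, hc⟩ := exists_heckeOperator_rightRegularLocal_eq_smul P w g
  exact ⟨c, hc x hx⟩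

/-- `T(ϖ^m)` is bounded by the number of cosets on `L²` (each `R(y)` is an isometry):
`‖T(ϖ^m) x‖ ≤ #(Δ_m K/K) ‖x‖`. [folklore] -/
theorem norm_heckeDetOperator_rightRegularLocal_le (w : HeightOneSpectrum (𝓞 K))
    {ϖ : w.adicCompletion K} (hϖ : IsUniformizingElement ϖ) (m : ℕ)
    (x : (AdelicGroupData.gl n K).L2 μ) :
    ‖heckeDetOperator (rightRegularLocal μ w) ϖ m x‖ ≤
      (finite_cosets_glIntDet (n := n) hϖ m).toFinset.card * ‖x‖ := by
  rw [heckeDetOperator_apply_eq_sum _ m (finite_cosets_glIntDet hϖ m)]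
  refine (norm_sum_le _ _).trans ?_
  rw [Finset.card_eq_sum_ones, Nat.cast_sum, Finset.sum_mul]
  refine Finset.sum_le_sum fun γ _ => ?_
  rw [Nat.cast_one, one_mul, rightRegularLocal_apply, AdelicGroupData.norm_rightRegular_apply]

/-- **Crude bound for the number of cosets in `K t_1 K`**: `#(K t_1 K / K) ≤ 2^n q^{n²}` (the
transversal of `HeckeTransversalGL` is indexed by pivot sets and residue tables). Any polynomial
bound in `q` suffices for the convergence of the Euler product in a right half-plane. [folklore] -/
theorem ncard_orbit_heckeDiag_one_le {F : Type*} [Field F] [ValuativeRel F] [Finite 𝓀[F]]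
    {ϖ : F} (hϖ : IsUniformizingElement ϖ) :
    (MulAction.orbit (glInt n F) ((heckeDiag n (Units.mk0 ϖ hϖ.ne_zero) 1 : GL (Fin n) F) :
        GL (Fin n) F ⧸ glInt n F)).ncard ≤ 2 ^ n * Nat.card 𝓀[F] ^ (n * n) := by
  classical
  rcases Nat.eq_zero_or_pos n with hn | hn
  · subst hn
    haveI : Subsingleton (GL (Fin 0) F) := ⟨fun a b => Units.ext (Subsingleton.elim _ _)⟩
    haveI : Subsingleton (GL (Fin 0) F ⧸ glInt 0 F) := Quotient.instSubsingletonQuotient _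
    calc (MulAction.orbit (glInt 0 F) ((heckeDiag 0 (Units.mk0 ϖ hϖ.ne_zero) 1 : GL (Fin 0) F) :
            GL (Fin 0) F ⧸ glInt 0 F)).ncard ≤ 1 := Set.ncard_le_one_of_subsingleton _
      _ = 2 ^ 0 * Nat.card 𝓀[F] ^ (0 * 0) := by simp
  · haveI : Fintype 𝓀[F] := Fintype.ofFinite _
    have hbij := bijOn_heckeTransversal (n := n) hϖ (r := 1) hn
    rw [← hbij.image_eq, hbij.injOn.ncard_image, Set.ncard_coe_finset]
    calc (heckeTransversal (n := n) hϖ.ne_zero 1).card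
        ≤ (Finset.univ : Finset (TransversalIndex n F 1)).card := Finset.card_image_le
      _ = Fintype.card (TransversalIndex n F 1) := Finset.card_univ
      _ ≤ Fintype.card (Finset (Fin n) × (Fin n → Fin n → 𝓀[F])) :=
          Fintype.card_le_of_injective (fun p : TransversalIndex n F 1 => p.1) Subtype.val_injective
      _ = 2 ^ n * Nat.card 𝓀[F] ^ (n * n) := by
          rw [Fintype.card_prod, Fintype.card_finset, Fintype.card_fin, Fintype.card_fun,
            Fintype.card_fun, Fintype.card_fin, ← pow_mul, Fintype.card_eq_nat_card, mul_comm n n]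

/-- **The local unramified Hecke eigen-series of `Π` at `w` (Tamagawa in Satake form).** Let `Π`
have Satake parameter `α` at `w` (level `K(𝔫)`, `w ∤ 𝔫 ≠ 0`, uniformizer `ϖ`). Then the operators
`T(ϖ^m)` of `ρ_w = R ∘ ι_w` act on the spherical vectors `Π^{GL_n(𝒪_w)} ⊂ L²` by scalars `r_m`
with `(∑_m r_m X^m) · ∏_{a ∈ α} (1 - q_w^{(n-1)/2} a X) = 1` in `ℂ⟦X⟧`
(`mk_heckeDetEigenvalue_mul_eulerFactor_eq_one`, Shimura (1971), Thm. 3.21, on the Satake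
eigenvector of `HasSatakeParameterAt` read in `L²`), and `|r_m| ≤ #(Δ_m K/K) ≤ (2^n q_w^{n²})^m`
(unitarity of `R` and the crude coset count). [cite: ShimuraIATAF1971, Theorem 3.21] -/
theorem exists_heckeDetEigenvalues_rightRegularLocal (P : CuspidalAutomorphicRepGL n K μ)
    {w : HeightOneSpectrum (𝓞 K)} {𝔫 : Ideal (𝓞 K)} (h𝔫 : 𝔫 ≠ 0) (hw : ¬ w.asIdeal ∣ 𝔫)
    {ϖ : (w.adicCompletion K)ˣ} {α : Multiset ℂ}
    (hα : HasSatakeParameterAt P.1 (principalCongruenceLevel n K 𝔫) w ϖ α)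
    (hϖ : IsUniformizingElement (ϖ : w.adicCompletion K)) :
    ∃ r : ℕ → ℂ,
      (∀ m, ∀ x ∈ sphericalVectorsAt μ P w,
        heckeDetOperator (rightRegularLocal μ w) (ϖ : w.adicCompletion K) m x = r m • x) ∧
      PowerSeries.mk r * ((α.map fun a => (1 : Polynomial ℂ) -
        Polynomial.C (((Real.sqrt (w.residueCard : ℝ) : ℝ) : ℂ) ^ (n - 1) * a) *
          Polynomial.X).prod : Polynomial ℂ) = 1 ∧
      (∀ m, ‖r m‖ ≤ 1 * ((2 : ℝ) ^ n * (w.residueCard : ℝ) ^ (n * n)) ^ m) ∧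
      ∀ m, ((finite_cosets_glIntDet (n := n) hϖ m).toFinset.card : ℝ) ≤
        ((2 : ℝ) ^ n * (w.residueCard : ℝ) ^ (n * n)) ^ m := by
  have hq : Nat.card 𝓀[w.adicCompletion K] = w.residueCard :=
    natCard_valuativeResidueField_adicCompletion_eq K w
  -- the scalars
  choose r hr using fun m => exists_heckeDetOperator_rightRegularLocal_eq_smul (μ := μ) P w hϖ m
  -- the Satake eigenvector, read in `L²`
  have hα' := hα
  obtain ⟨-, hcardα, f, hf, hf0, -⟩ := hα'
  have hfK : ∀ k ∈ principalCongruenceLevel n K 𝔫,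
      (AdelicGroupData.gl n K).rightRegular μ k (f : (AdelicGroupData.gl n K).L2 μ) = f := by
    intro k hk
    exact congrArg Subtype.val ((ContRepresentation.ClosedSubrep.mem_fixedVectors _ _ _).1 hf k hk)
  have hfsph : (f : (AdelicGroupData.gl n K).L2 μ) ∈ sphericalVectorsAt μ P w := by
    refine mem_sphericalVectorsAt_iff.2 ⟨f.2, fun k hk => hfK _ ?_⟩
    refine isMaximalAt_principalCongruenceLevel n K w h𝔫 hw ⟨k, ?_, rfl⟩
    rwa [← glInt_adicCompletion_eq]
  have hf0' : (f : (AdelicGroupData.gl n K).L2 μ) ≠ 0 := fun h => hf0 (Subtype.ext h)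
  -- coset counts
  have hcard : ∀ m, ((finite_cosets_glIntDet (n := n) hϖ m).toFinset.card : ℝ) ≤
      ((2 : ℝ) ^ n * (w.residueCard : ℝ) ^ (n * n)) ^ m := fun m => by
    have h1 := card_cosets_glIntDet_le_pow (n := n) hϖ m
    have h2 := ncard_orbit_heckeDiag_one_le (n := n) hϖ
    rw [hq] at h2
    calc ((finite_cosets_glIntDet (n := n) hϖ m).toFinset.card : ℝ)
        ≤ ((MulAction.orbit (glInt n (w.adicCompletion K))
            ((heckeDiag n (Units.mk0 (ϖ : w.adicCompletion K) hϖ.ne_zero) 1 :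
              GL (Fin n) (w.adicCompletion K)) :
                GL (Fin n) (w.adicCompletion K) ⧸ glInt n (w.adicCompletion K))).ncard : ℝ) ^ m := by
          exact_mod_cast h1
      _ ≤ ((2 : ℝ) ^ n * (w.residueCard : ℝ) ^ (n * n)) ^ m := by
          gcongr
          exact_mod_cast h2
  -- bounds for `r`
  have hrB : ∀ m, ‖r m‖ ≤ 1 * ((2 : ℝ) ^ n * (w.residueCard : ℝ) ^ (n * n)) ^ m := fun m => by
    rw [one_mul]
    refine le_trans ?_ (hcard m)
    have h := norm_heckeDetOperator_rightRegularLocal_le (μ := μ) w hϖ m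
      (f : (AdelicGroupData.gl n K).L2 μ)
    rw [hr m _ hfsph, norm_smul] at h
    exact le_of_mul_le_mul_right h (norm_pos_iff.2 hf0')
  refine ⟨r, hr, ?_, hrB, hcard⟩
  -- Tamagawa's identity in Satake form on `f`
  have hτ : ∀ i ≤ n, heckeOperator (rightRegularLocal μ w) (glInt n (w.adicCompletion K))
      (heckeDiag n (Units.mk0 (ϖ : w.adicCompletion K) hϖ.ne_zero) i)
        (f : (AdelicGroupData.gl n K).L2 μ) =
      ((((Real.sqrt (Nat.card 𝓀[w.adicCompletion K]) : ℝ) : ℂ) ^ (i * (n - i))) * α.esymm i) •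
        (f : (AdelicGroupData.gl n K).L2 μ) := by
    intro i hi
    rw [Units.mk0_val, hq]
    exact heckeOperator_rightRegularLocal_heckeDiag_eq_smul h𝔫 hw hα hfsph hi
  have h := mk_heckeDetEigenvalue_mul_eulerFactor_eq_one (rightRegularLocal μ w) hϖ hfsph.2 hf0'
    hcardα hτ (fun m => hr m _ hfsph)
  rw [hq] at h
  exact h

open scoped InnerProductSpace in
/-- **The unramified local factor of the unfolded zeta integral, at the place `w`.** With the
eigenvalues `r_m` of `exists_heckeDetEigenvalues_rightRegularLocal` (any `r`, `D` satisfying its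
conclusions), for a spherical `x ∈ Π` at `w`, any `ψ ∈ L²` and `|X| D < 1`:
`∑_{y GL_n(𝒪_w) ⊆ Δ^{(w)}} X^{m(y)} ⟪ψ, R(ι_w y) x⟫ = (∏_{a ∈ α} (1 - q_w^{(n-1)/2} a X))⁻¹ ⟪ψ, x⟫`,
absolutely convergent (`hasSum_intCosets_pow_detExponent_mul` with the bounded coefficient
`|⟪ψ, R(g) x⟫| ≤ ‖ψ‖ ‖x‖`, and `∑ r_m X^m = (∏ (1 - q^{(n-1)/2} a X))⁻¹`,
`tsum_mul_prod_one_sub_eq_one`). With `X = q_w^{-s-(n-1)/2}` the right-hand side is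
`L(s, Π_w) ⟪ψ, x⟫` — the unramified computation of Godement–Jacquet (1972), Lemma 6.10, in the
global (`L²`) model. [cite: GodementJacquet1972, Lemma 6.10] -/
theorem hasSum_intCosets_inner_rightRegularLocal {P : CuspidalAutomorphicRepGL n K μ}
    {w : HeightOneSpectrum (𝓞 K)} {ϖ : (w.adicCompletion K)ˣ}
    (hϖ : IsUniformizingElement (ϖ : w.adicCompletion K)) {α : Multiset ℂ} {r : ℕ → ℂ}
    (hr : ∀ m, ∀ x ∈ sphericalVectorsAt μ P w,
      heckeDetOperator (rightRegularLocal μ w) (ϖ : w.adicCompletion K) m x = r m • x)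
    (hmk : PowerSeries.mk r * ((α.map fun a => (1 : Polynomial ℂ) -
        Polynomial.C (((Real.sqrt (w.residueCard : ℝ) : ℝ) : ℂ) ^ (n - 1) * a) *
          Polynomial.X).prod : Polynomial ℂ) = 1)
    {D : ℝ} (hD : 0 ≤ D) (hrB : ∀ m, ‖r m‖ ≤ 1 * D ^ m)
    (hcard : ∀ m, ((finite_cosets_glIntDet (n := n) hϖ m).toFinset.card : ℝ) ≤ D ^ m)
    {x : (AdelicGroupData.gl n K).L2 μ} (hx : x ∈ sphericalVectorsAt μ P w)
    (ψ : (AdelicGroupData.gl n K).L2 μ) {X : ℂ} (hX : ‖X‖ * D < 1) :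
    HasSum (fun c : intCosets n (w.adicCompletion K) =>
        X ^ detExponent hϖ c * ⟪ψ, (AdelicGroupData.gl n K).rightRegular μ
          (GLn.ofLocal n K w (c.1.out : GL (Fin n) (w.adicCompletion K))) x⟫_ℂ)
      (((α.map fun a => 1 - ((Real.sqrt (w.residueCard : ℝ) : ℝ) : ℂ) ^ (n - 1) * a * X).prod)⁻¹ *
        ⟪ψ, x⟫_ℂ) := by
  set ℓ : (AdelicGroupData.gl n K).L2 μ →ₗ[ℂ] ℂ :=
    ((innerSL ℂ ψ : (AdelicGroupData.gl n K).L2 μ →L[ℂ] ℂ) : (AdelicGroupData.gl n K).L2 μ →ₗ[ℂ] ℂ)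
    with hℓ
  have hB : ∀ g, ‖ℓ (rightRegularLocal μ w g x)‖ ≤ ‖ψ‖ * ‖x‖ := fun g => by
    rw [hℓ, ContinuousLinearMap.coe_coe, innerSL_apply_apply, rightRegularLocal_apply,
      ← AdelicGroupData.norm_rightRegular_apply (𝒢 := AdelicGroupData.gl n K) μ (GLn.ofLocal n K w g) x]
    exact norm_inner_le_norm _ _
  obtain ⟨-, hsum⟩ := hasSum_intCosets_pow_detExponent_mul hϖ (rightRegularLocal μ w) ℓ
    (fun m => hr m x hx) hB hD hrB hcard hX
  have htsum : ∑' m, r m * X ^ m =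
      ((α.map fun a => 1 - ((Real.sqrt (w.residueCard : ℝ) : ℝ) : ℂ) ^ (n - 1) * a * X).prod)⁻¹ :=
    eq_inv_of_mul_eq_one_left (tsum_mul_prod_one_sub_eq_one hmk hD hrB hX).2
  rw [htsum] at hsum
  exact hsum

/-- `|ϖ|_w = q_w⁻¹` for a uniformizer in the adelic normalisation `v(ϖ) = exp (-1)` (Mathlib's norm
on `K_w`, `FinitePlace.norm_def`, base `absNorm w = q_w`). [folklore] -/
theorem norm_eq_inv_residueCard_of_valued_eq {w : HeightOneSpectrum (𝓞 K)} {ϖ : w.adicCompletion K}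
    (h : Valued.v ϖ = WithZero.exp (-1 : ℤ)) : ‖ϖ‖ = (w.residueCard : ℝ)⁻¹ := by
  rw [FinitePlace.norm_def, h, WithZero.exp, WithZeroMulInt.toNNReal_neg_apply _ WithZero.coe_ne_zero,
    WithZero.unzero_coe, toAdd_ofAdd, zpow_neg, zpow_one, NNReal.coe_inv, NNReal.coe_natCast]
  rfl

/-- Elements of `K_w` with the same `ValuativeRel` valuation have the same norm. [folklore] -/
theorem norm_eq_norm_of_valuation_eq {w : HeightOneSpectrum (𝓞 K)} {a b : w.adicCompletion K}
    (h : valuation (w.adicCompletion K) a = valuation (w.adicCompletion K) b) : ‖a‖ = ‖b‖ := by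
  have h' : Valued.v a = Valued.v b :=
    ((ValuativeRel.isEquiv (valuation (w.adicCompletion K))
      (Valued.v : Valuation (w.adicCompletion K) _)).eq_iff).1 h
  rw [FinitePlace.norm_def, FinitePlace.norm_def, h']

/-- **`|det y|_w = q_w^{-m(y)}` on the integral cosets** (`y ∈ Δ_{m(y)}`,
`|det y|_w = |ϖ|_w^{m(y)}`, `|ϖ|_w = q_w⁻¹`). [folklore] -/
theorem norm_det_out_eq_inv_pow {w : HeightOneSpectrum (𝓞 K)} {ϖ : w.adicCompletion K}
    (hval : Valued.v ϖ = WithZero.exp (-1 : ℤ)) (hϖ : IsUniformizingElement ϖ)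
    (c : intCosets n (w.adicCompletion K)) :
    ‖((c.1.out : GL (Fin n) (w.adicCompletion K)) : Matrix (Fin n) (Fin n) (w.adicCompletion K)).det‖ =
      ((w.residueCard : ℝ)⁻¹) ^ detExponent hϖ c := by
  have h := (out_mem_glIntDet_detExponent hϖ c).2
  rw [← map_pow] at h
  rw [norm_eq_norm_of_valuation_eq h, norm_pow, norm_eq_inv_residueCard_of_valued_eq hval]

end Adelic

end Literature.NumberTheory.Automorphic
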